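import Mathlib.Tactic.Linarith
import Summits.CriticalPhenomena.PercolationContinuityZ3.Theorems.PercNearOneGluingNoHeavyLowerTailSahiCTCRPrime
import Summits.CriticalPhenomena.PercolationContinuityZ3.Theorems.PercNearOneGluingNoHeavyLowerTailSahiCTCLadderNested
import HarnessLib

/-!
# `NoHeavyLowerTail` (crux stmt-CriticalPhenomena-4575), P3 lane: the CO-LEVEL-2 ROW REDUCES TO THE LADDER FORM OF THE ALL-LIVE PARTS —
# `M₂(𝒳,𝒵) = Π·L₂(𝒳₊,𝒵₊) + e₂·R'(𝒳,𝒵)` and `M₂ ∈ ℕ[s]` whenever `L₂(𝒳₊,𝒵₊) ∈ ℕ[s]` (every pair of up-sets, every finite type)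

Support file (seat `prim-l12-p3`, gen 24; `--supports stmt-CriticalPhenomena-4575`).  Memo `run/shared/lean/prim/prim-l12/FROM-prim-l12-p3-g24-VALUE-
LEVEL-TH2K.md` §3c/§7 and memo g23 §DUALITY.  The open-language master polynomial of the (TC) row of the slot "at least two of k open" (the
`t = 2` case of `…SahiCTCLevelDuality.Mop`, written out here with the same eight products) is
  `M₂ = e₂(Π+Θ₁)(Π·Y₂ − X₂Z₂) − Π·e_{≥2}·Θ₁·GF(W₂) − e₂Θ₁(X₂Z₁ + X₁Z₂) + e₂·e_{≥2}·X₁Z₁`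
(`X₂ = GF(members of size ≥ 2)`, `X₁ = GF(members of size < 2)`, `Y₂ = GF(common members of size ≥ 2)`, `W₂` = common 2-sets).  This file proves
* `Mtwo_eq_split` : **`M₂ = Π·T + e₂·R'`** with `T = e₂(Π·Y₂ − X₂Z₂) − Θ₁·e_{≥2}·GF(W₂)` — the ladder form `L₂` of the all-live parts `𝒳₊ = atLeast 2 𝒳`,
  `𝒵₊` — and `R' = Θ₁(Π·Y₂ − X·Z) + Π·X₁Z₁` (a ring identity);
* **`coeff_Mtwo_nonneg_of_ladder`** : for up-sets `𝒳, 𝒵`, if `L₂(𝒳₊,𝒵₊) ∈ ℕ[s]` then `M₂(𝒳,𝒵) ∈ ℕ[s]` (by `…SahiCTCRPrime.coeff_Rprime_nonneg`);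
* **`coeff_Mtwo_nonneg_of_subset`** : hence `M₂(𝒳,𝒵) ∈ ℕ[s]` for every pair of up-sets whose all-live parts are NESTED (`atLeast 2 𝒳 ⊆ atLeast 2 𝒵` or
  conversely), by `…SahiCTCLadderNested` — loops and small members unrestricted.
So the co-level-2 programme (CTC_{k−2}(k) for every k, and the crux's value-level hypothesis) is reduced to the single statement `L₂ ∈ ℕ[s]` for
all-live pairs (memo g24 §5.5–5.7).  Nothing is asserted about the crux.
-/

namespace Summit.CriticalPhenomena.PercolationContinuityZ3.Theorems.SahiCTCForms

open Finset MvPolynomial SahiCTCGenFun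

variable {α : Type*} [DecidableEq α] [Fintype α]

omit [DecidableEq α] [Fintype α] in
/-- `{S : #S < 2} = {S : #S ≤ 1}` inside any family. [this work] -/
theorem filter_card_lt_two_eq (F : Finset (Finset α)) : (F.filter fun S => #S < 2) = F.filter fun S => #S ≤ 1 :=
  filter_congr fun S _ => by omega

omit [DecidableEq α] in
/-- `bySize (· < 2) = bySize (· ≤ 1)` (`= Θ₁`'s family). [this work] -/
theorem bySize_lt_two_eq : (bySize (· < 2) : Finset (Finset α)) = bySize (· ≤ 1) := by
  unfold bySize; exact filter_congr fun S _ => by simp only; omega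

omit [Fintype α] in
/-- The all-live parts of an intersection: `atLeast 2 (𝒳 ∩ 𝒵) = atLeast 2 𝒳 ∩ atLeast 2 𝒵` (as filters). [this work] -/
theorem filter_two_le_inter (𝒳 𝒵 : Finset (Finset α)) :
    ((𝒳 ∩ 𝒵).filter fun S => 2 ≤ #S) = (𝒳.filter fun S => 2 ≤ #S) ∩ (𝒵.filter fun S => 2 ≤ #S) := by
  ext S; simp only [mem_filter, mem_inter]; tauto

omit [DecidableEq α] [Fintype α] in
/-- The 2-sets of the all-live part are the 2-sets. [this work] -/
theorem filter_two_le_filter_eq_two (𝒴 : Finset (Finset α)) :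
    ((𝒴.filter fun S => 2 ≤ #S).filter fun S => #S = 2) = 𝒴.filter fun S => #S = 2 := by
  ext S; simp only [mem_filter]; constructor
  · rintro ⟨⟨h1, _⟩, h3⟩; exact ⟨h1, h3⟩
  · rintro ⟨h1, h3⟩; exact ⟨⟨h1, by omega⟩, h3⟩

omit [DecidableEq α] [Fintype α] in
/-- An up-set's members of size `≥ 2` form an up-set. [this work] -/
theorem isUpperSet_filter_two_le {𝒳 : Finset (Finset α)} (h𝒳 : IsUpperSet (𝒳 : Set (Finset α))) :
    IsUpperSet ((𝒳.filter fun S => 2 ≤ #S : Finset (Finset α)) : Set (Finset α)) := by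
  intro A B hAB hA
  rw [Finset.mem_coe, mem_filter] at hA ⊢
  exact ⟨h𝒳 hAB hA.1, hA.2.trans (card_le_card hAB)⟩

/-- **`M₂ = Π·T + e₂·R'`** (g23's split in the open-set language; pure algebra from `X = X₂ + X₁`). [this work] -/
theorem Mtwo_eq_split (𝒳 𝒵 : Finset (Finset α)) :
    (gf (bySize (· = 2)) * gf univ.powerset) * (gf univ.powerset * gf ((𝒳 ∩ 𝒵).filter fun S => 2 ≤ #S))
    - (gf (bySize (· = 2)) * gf univ.powerset) * (gf (𝒳.filter fun S => 2 ≤ #S) * gf (𝒵.filter fun S => 2 ≤ #S))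
    + (gf (bySize (· = 2)) * gf (bySize (· < 2))) * (gf univ.powerset * gf ((𝒳 ∩ 𝒵).filter fun S => 2 ≤ #S))
    - (gf (bySize (· = 2)) * gf (bySize (· < 2))) * (gf (𝒳.filter fun S => 2 ≤ #S) * gf (𝒵.filter fun S => 2 ≤ #S))
    - (gf (bySize (2 ≤ ·)) * gf univ.powerset) * (gf (bySize (· < 2)) * gf ((𝒳 ∩ 𝒵).filter fun S => #S = 2))
    - (gf (bySize (· = 2)) * gf (bySize (· < 2))) * (gf (𝒳.filter fun S => 2 ≤ #S) * gf (𝒵.filter fun S => #S < 2))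
    - (gf (bySize (· = 2)) * gf (bySize (· < 2))) * (gf (𝒳.filter fun S => #S < 2) * gf (𝒵.filter fun S => 2 ≤ #S))
    + (gf (bySize (· = 2)) * gf (bySize (2 ≤ ·))) * (gf (𝒳.filter fun S => #S < 2) * gf (𝒵.filter fun S => #S < 2))
    = PiP * (ee 2 * (PiP * gf ((𝒳.filter fun S => 2 ≤ #S) ∩ (𝒵.filter fun S => 2 ≤ #S))
              - gf (𝒳.filter fun S => 2 ≤ #S) * gf (𝒵.filter fun S => 2 ≤ #S))
            - Th1 * (PiP - Th1) * gf ((((𝒳.filter fun S => 2 ≤ #S) ∩ (𝒵.filter fun S => 2 ≤ #S))).filter fun S => #S = 2))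
      + ee 2 * (Th1 * (PiP * gf ((𝒳 ∩ 𝒵).filter fun S => 2 ≤ #S) - gf 𝒳 * gf 𝒵)
              + PiP * gf (𝒳.filter fun S => #S ≤ 1) * gf (𝒵.filter fun S => #S ≤ 1)) := by
  have hX : gf 𝒳 = gf (𝒳.filter fun S => 2 ≤ #S) + gf (𝒳.filter fun S => #S ≤ 1) := by
    rw [gf_filter_two_le_eq]; ring
  have hZ : gf 𝒵 = gf (𝒵.filter fun S => 2 ≤ #S) + gf (𝒵.filter fun S => #S ≤ 1) := by
    rw [gf_filter_two_le_eq]; ring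
  have hG2 : gf (bySize (2 ≤ ·) : Finset (Finset α)) = PiP - Th1 := by rw [PiP_eq_Th1_add_gf_atLeastTwo]; ring
  rw [← filter_two_le_inter, filter_two_le_filter_eq_two, filter_card_lt_two_eq, filter_card_lt_two_eq, bySize_lt_two_eq,
    hG2, hX, hZ]
  unfold ee Th1 PiP
  ring

/-- **The co-level-2 row is nonnegative coefficientwise as soon as the ladder form of the all-live parts is** (every pair of up-sets). [this work] -/
theorem coeff_Mtwo_nonneg_of_ladder {𝒳 𝒵 : Finset (Finset α)} (h𝒳 : IsUpperSet (𝒳 : Set (Finset α)))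
    (h𝒵 : IsUpperSet (𝒵 : Set (Finset α)))
    (hL : ∀ m, 0 ≤ (ee 2 * (PiP * gf ((𝒳.filter fun S => 2 ≤ #S) ∩ (𝒵.filter fun S => 2 ≤ #S))
              - gf (𝒳.filter fun S => 2 ≤ #S) * gf (𝒵.filter fun S => 2 ≤ #S))
            - Th1 * (PiP - Th1) * gf ((((𝒳.filter fun S => 2 ≤ #S) ∩ (𝒵.filter fun S => 2 ≤ #S))).filter fun S => #S = 2)).coeff m)
    (n : α →₀ ℕ) :
    0 ≤ ((gf (bySize (· = 2)) * gf univ.powerset) * (gf univ.powerset * gf ((𝒳 ∩ 𝒵).filter fun S => 2 ≤ #S))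
    - (gf (bySize (· = 2)) * gf univ.powerset) * (gf (𝒳.filter fun S => 2 ≤ #S) * gf (𝒵.filter fun S => 2 ≤ #S))
    + (gf (bySize (· = 2)) * gf (bySize (· < 2))) * (gf univ.powerset * gf ((𝒳 ∩ 𝒵).filter fun S => 2 ≤ #S))
    - (gf (bySize (· = 2)) * gf (bySize (· < 2))) * (gf (𝒳.filter fun S => 2 ≤ #S) * gf (𝒵.filter fun S => 2 ≤ #S))
    - (gf (bySize (2 ≤ ·)) * gf univ.powerset) * (gf (bySize (· < 2)) * gf ((𝒳 ∩ 𝒵).filter fun S => #S = 2))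
    - (gf (bySize (· = 2)) * gf (bySize (· < 2))) * (gf (𝒳.filter fun S => 2 ≤ #S) * gf (𝒵.filter fun S => #S < 2))
    - (gf (bySize (· = 2)) * gf (bySize (· < 2))) * (gf (𝒳.filter fun S => #S < 2) * gf (𝒵.filter fun S => 2 ≤ #S))
    + (gf (bySize (· = 2)) * gf (bySize (2 ≤ ·))) * (gf (𝒳.filter fun S => #S < 2) * gf (𝒵.filter fun S => #S < 2)) :
      MvPolynomial α ℤ).coeff n := by
  rw [Mtwo_eq_split, coeff_add]
  refine add_nonneg (coeff_mul_nonneg (fun m => by unfold PiP; exact coeff_gf_nonneg _ m) hL n) ?_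
  exact coeff_mul_nonneg (fun m => by unfold ee; exact coeff_gf_nonneg _ m) (coeff_Rprime_nonneg h𝒳 h𝒵) n

/-- **`M₂(𝒳,𝒵) ∈ ℕ[s]` for every pair of up-sets whose ALL-LIVE PARTS ARE NESTED** (`{S ∈ 𝒳 : #S ≥ 2} ⊆ {S ∈ 𝒵 : #S ≥ 2}`); loops and small members are
unrestricted.  (By symmetry of `M₂` the converse inclusion works too.) [this work] -/
theorem coeff_Mtwo_nonneg_of_subset {𝒳 𝒵 : Finset (Finset α)} (h𝒳 : IsUpperSet (𝒳 : Set (Finset α)))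
    (h𝒵 : IsUpperSet (𝒵 : Set (Finset α))) (hsub : (𝒳.filter fun S => 2 ≤ #S) ⊆ (𝒵.filter fun S => 2 ≤ #S)) (n : α →₀ ℕ) :
    0 ≤ ((gf (bySize (· = 2)) * gf univ.powerset) * (gf univ.powerset * gf ((𝒳 ∩ 𝒵).filter fun S => 2 ≤ #S))
    - (gf (bySize (· = 2)) * gf univ.powerset) * (gf (𝒳.filter fun S => 2 ≤ #S) * gf (𝒵.filter fun S => 2 ≤ #S))
    + (gf (bySize (· = 2)) * gf (bySize (· < 2))) * (gf univ.powerset * gf ((𝒳 ∩ 𝒵).filter fun S => 2 ≤ #S))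
    - (gf (bySize (· = 2)) * gf (bySize (· < 2))) * (gf (𝒳.filter fun S => 2 ≤ #S) * gf (𝒵.filter fun S => 2 ≤ #S))
    - (gf (bySize (2 ≤ ·)) * gf univ.powerset) * (gf (bySize (· < 2)) * gf ((𝒳 ∩ 𝒵).filter fun S => #S = 2))
    - (gf (bySize (· = 2)) * gf (bySize (· < 2))) * (gf (𝒳.filter fun S => 2 ≤ #S) * gf (𝒵.filter fun S => #S < 2))
    - (gf (bySize (· = 2)) * gf (bySize (· < 2))) * (gf (𝒳.filter fun S => #S < 2) * gf (𝒵.filter fun S => 2 ≤ #S))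
    + (gf (bySize (· = 2)) * gf (bySize (2 ≤ ·))) * (gf (𝒳.filter fun S => #S < 2) * gf (𝒵.filter fun S => #S < 2)) :
      MvPolynomial α ℤ).coeff n := by
  refine coeff_Mtwo_nonneg_of_ladder h𝒳 h𝒵 (fun m => ?_) n
  exact coeff_ladder_two_nonneg_of_subset_PiP (isUpperSet_filter_two_le h𝒳) (fun S hS => (mem_filter.1 hS).2)
    (fun S hS => (mem_filter.1 hS).2) hsub m

end Summit.CriticalPhenomena.PercolationContinuityZ3.Theorems.SahiCTCForms
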